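import Mathlib
import Summits.PneNP.PneNP.Theorems.ConvexRankGatesConvexGateBlindXorDefs
import Summits.PneNP.PneNP.Theorems.CliqueExtLowerBound.Negative.Padding

/-!
# PneNP / ConvexRankGates — `ConvexGateBlind`, line `xor-door-perfect-completeness`: `Transport`

Helper file for the crux `ConvexGateBlind` (item `stmt-PneNP-10680`, `--supports`; closes nothing by
itself). It proves the generic transport statement `Transport` of the line: CONV-circuit hardness
moves DOWN along polynomial monotone AND-projections of `CLIQUE`. If every `f n` is a monotone
AND-projection of some `CLIQUE(M, k)` with `M, k ≤ (n+2)^a`, then CONV-blindness of the family `f`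
implies the crux `ConvexGateBlind` (at the exponent `δ = 1/4`).

Proof (contrapositive, `stub_transport`; the crux is definitionally
`∃ δ ∈ (0,1/2), LowerBoundAtOver conv ⌈m^δ⌉₊`, cf. `convexGateBlind_iff_over` in
`Negative/DeltaMonotone.lean`). If the lower bound at `⌈m^{1/4}⌉₊` fails over the convex family,
some exponent `c` admits, for infinitely many `m`, a `{∧₂, ∨₂} ∪ CONV_{m^c}`-circuit with `≤ m^c`
gates computing `CLIQUE(m, K)`, `K = ⌈m^{1/4}⌉₊`. For such an `m` let `n` be the largest integer
with `(n+2)^a ≤ K` (`exists_pow_le_lt`), take the projection `ρ` of `f n` onto `CLIQUE(M, k)`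
(`M, k ≤ K`) and embed the board `K_M` into `K_m`: the `M` live vertices, then `K - k` apex
vertices joined to everything before them (`padVec`, `cliqueFn_padVec` of `Negative/Padding.lean`),
the remaining vertices isolated (`zeroVec`, `cliqueFn_zeroVec`: a `K`-clique, `K ≥ 2`, avoids
isolated vertices). Substituting the literals `ρ e` (constants, variables, `∧` of two variables:
one gate each over any basis with `∧₂` and the two constants, `cktSize_lit`) and composing with
the cheap circuit gives a `{∧₂, ∨₂} ∪ CONV`-circuit of size `≤ 3m² + m^c ≤ n^{8a(c+4)}` computing
`f n` (`m ≤ K^4 < (n+3)^{4a}`, `size_bookkeeping`); since `n → ∞` with `m`, this contradicts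
`ConvBlind P f` at the exponent `8a(c+4)`.
-/

set_option linter.dupNamespace false -- `Summit.PneNP.PneNP.…`: summit = sub-problem (D-0017)

namespace Summit.PneNP.PneNP.Theorems.XorDoor

open Filter Finset
open Literature.Computability.Complexity hiding E
open Summit.PneNP.PneNP.Theses.ConvexRankGates (ConvexGateBlind)
open Summit.PneNP.PneNP.Theorems.CliqueExtLowerBound.Negative

/-! ## §1 Isolated-vertex padding of the clique function -/

section ZeroPadding

variable {m' m : ℕ} (hm : m' ≤ m)

open scoped Classical in
/-- Extension of an edge vector of `K_{m'}` to `K_m` by zeros: live edges keep their value, every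
edge at a new vertex is switched off (the new vertices are isolated). [folklore] -/
noncomputable def zeroVec (x' : E m' → Bool) (e : E m) : Bool :=
  if h : ∃ e', padEdge hm e' = e then x' h.choose else false

/-- Live edges keep their value. [folklore] -/
theorem zeroVec_padEdge (x' : E m' → Bool) (e' : E m') : zeroVec hm x' (padEdge hm e') = x' e' := by
  classical
  unfold zeroVec
  have h : ∃ e'', padEdge hm e'' = padEdge hm e' := ⟨e', rfl⟩
  rw [dif_pos h, padEdge_injective hm h.choose_spec]

/-- An edge that is switched on is a live edge whose preimage is switched on. [folklore] -/
theorem exists_of_zeroVec_eq_true {x' : E m' → Bool} {e : E m} (h : zeroVec hm x' e = true) :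
    ∃ e', padEdge hm e' = e ∧ x' e' = true := by
  classical
  unfold zeroVec at h
  by_cases h' : ∃ e', padEdge hm e' = e
  · rw [dif_pos h'] at h
    exact ⟨h'.choose, h'.choose_spec, h⟩
  · rw [dif_neg h'] at h
    exact absurd h Bool.false_ne_true

-- adapted from Cruxes/ConvexGateBlind/Disproof.lean §E.6 (`cliqueFn_extZ`)
/-- **Zero padding.** For `k ≥ 2`, `CLIQUE(m, k)` on the zero-extended vector is `CLIQUE(m', k)`:
a `k`-clique with `k ≥ 2` has no isolated vertex, so it lies on the live vertices. [folklore] -/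
theorem cliqueFn_zeroVec (x' : E m' → Bool) {k : ℕ} (hk : 2 ≤ k) :
    cliqueFn m k (zeroVec hm x') = cliqueFn m' k x' := by
  classical
  rw [Bool.eq_iff_iff, CliqueLPGate.cliqueFn_eq_true_iff_exists,
    CliqueLPGate.cliqueFn_eq_true_iff_exists]
  constructor
  · rintro ⟨S, hS, hx⟩
    -- every vertex of `S` is live: it has a neighbour in `S` and the edge to it is switched on
    have hlive : ∀ v ∈ S, (v : ℕ) < m' := by
      intro v hv
      obtain ⟨w, hw, hwv⟩ : ∃ w ∈ S, w ≠ v := by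
        by_contra h
        push Not at h
        have hsub : S ⊆ {v} := fun w hw => Finset.mem_singleton.2 (h w hw)
        have := Finset.card_le_card hsub
        rw [hS, Finset.card_singleton] at this
        omega
      have he : s(v, w) ∈ (⊤ : SimpleGraph (Fin m)).edgeSet :=
        (SimpleGraph.mem_edgeSet ⊤).2 ((SimpleGraph.top_adj v w).2 hwv.symm)
      have hxe := hx ⟨s(v, w), he⟩ (fun y hy => by
        rcases Sym2.mem_iff.1 hy with rfl | rfl
        · exact hv
        · exact hw)
      obtain ⟨e', he', -⟩ := exists_of_zeroVec_eq_true hm hxe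
      exact (lt_of_padEdge_eq hm he').1
    set T : Finset (Fin m') := Finset.univ.filter fun a => Fin.castLE hm a ∈ S with hT
    refine ⟨T, ?_, fun e' he' => ?_⟩
    · rw [← hS]
      refine Finset.card_bij (fun a _ => Fin.castLE hm a) (fun a ha => (Finset.mem_filter.1 ha).2)
        (fun a _ b _ h => Fin.castLE_injective hm h) (fun v hv => ?_)
      refine ⟨⟨v, hlive v hv⟩, Finset.mem_filter.2 ⟨Finset.mem_univ _, ?_⟩, Fin.ext rfl⟩
      have : Fin.castLE hm ⟨v, hlive v hv⟩ = v := Fin.ext rfl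
      rwa [this]
    · rw [← zeroVec_padEdge hm x']
      refine hx _ fun y hy => ?_
      obtain ⟨e'v, he'E⟩ := e'
      induction e'v using Sym2.ind with
      | h a b =>
        have ha : a ∈ T := he' a (Sym2.mem_mk_left a b)
        have hb : b ∈ T := he' b (Sym2.mem_mk_right a b)
        simp only [hT, Finset.mem_filter, Finset.mem_univ, true_and] at ha hb
        simp only [padEdge, Sym2.map_mk, Sym2.mem_iff] at hy
        rcases hy with rfl | rfl
        · exact ha
        · exact hb
  · rintro ⟨T, hT, hx⟩
    refine ⟨T.map (Fin.castLEEmb hm), by rw [Finset.card_map, hT], fun e he => ?_⟩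
    obtain ⟨e, heE⟩ := e
    induction e using Sym2.ind with
    | h u v =>
      obtain ⟨a, ha, hau⟩ := Finset.mem_map.1 (he u (Sym2.mem_mk_left u v))
      obtain ⟨b, hb, hbv⟩ := Finset.mem_map.1 (he v (Sym2.mem_mk_right u v))
      have hau' : Fin.castLE hm a = u := hau
      have hbv' : Fin.castLE hm b = v := hbv
      have hne : u ≠ v := (SimpleGraph.top_adj u v).1 ((SimpleGraph.mem_edgeSet ⊤).1 heE)
      have hab : a ≠ b := fun h => hne (by rw [← hau', ← hbv', h])
      have he' : s(a, b) ∈ (⊤ : SimpleGraph (Fin m')).edgeSet :=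
        (SimpleGraph.mem_edgeSet ⊤).2 ((SimpleGraph.top_adj a b).2 hab)
      have hemb : padEdge hm ⟨s(a, b), he'⟩ = ⟨s(u, v), heE⟩ :=
        Subtype.ext (by simp only [padEdge, Sym2.map_mk, hau', hbv'])
      rw [← hemb, zeroVec_padEdge]
      exact hx _ fun y hy => by
        rcases Sym2.mem_iff.1 hy with rfl | rfl
        · exact ha
        · exact hb

/-- The zero-padding map `x' ↦ zeroVec x'` costs at most `#E(K_m)` gates over any basis `B`
containing the arity-`0` constant `false` (as `∨₀`): a projection for a live edge, one constant gate
for a dead edge. [folklore] -/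
theorem cktSize_zeroVec {B : Set GateFn} (hB : GateFn.or 0 ∈ B) :
    CktSize B (fun (x' : E m' → Bool) (e : E m) => zeroVec hm x' e) (Fintype.card (E m) * 1) := by
  classical
  refine CktSize.pi_const fun e => ?_
  by_cases h : ∃ e', padEdge hm e' = e
  · refine ((CktSize.proj B fun _ : Unit => h.choose).of_le (Nat.zero_le 1)).congr fun x' _ => ?_
    show x' h.choose = zeroVec hm x' e
    unfold zeroVec
    rw [dif_pos h]
  · refine (CktSize.gate (B := B) (GateFn.or 0) hB Fin.elim0).congr fun x' _ => ?_
    show decide (∃ i : Fin 0, x' (Fin.elim0 i) = true) = zeroVec hm x' e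
    unfold zeroVec
    rw [dif_neg h]
    simp

end ZeroPadding

/-! ## §2 Substituting literals: one gate each -/

/-- A literal (constant, variable, or `∧` of two variables) is computed with at most one gate over
any basis containing `∧₂`, the constant `true` (arity `0`) and the constant `false` (as `∨₀`).
[folklore] -/
theorem cktSize_lit {ι : Type} {B : Set GateFn} (hT : (⟨0, fun _ => true⟩ : GateFn) ∈ B)
    (hF : GateFn.or 0 ∈ B) (hA : GateFn.and 2 ∈ B) (l : Lit ι) :
    CktSize B (fun (x : ι → Bool) (_ : Unit) => l.eval x) 1 := by
  cases l with
  | const b =>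
    cases b
    · exact (CktSize.gate (B := B) (ι := ι) (GateFn.or 0) hF Fin.elim0).congr fun x _ => by
        simp [GateFn.or, Lit.eval]
    · exact (CktSize.gate (B := B) (ι := ι) ⟨0, fun _ => true⟩ hT Fin.elim0).congr fun x _ => rfl
  | var a => exact ((CktSize.proj B fun _ : Unit => a).of_le (Nat.zero_le 1)).congr fun x _ => rfl
  | and a b =>
    exact (CktSize.gate (B := B) (GateFn.and 2) hA ![a, b]).congr fun x _ => by
      simp only [GateFn.and, Fin.forall_fin_two, Matrix.cons_val_zero, Matrix.cons_val_one,
        Bool.decide_and, Bool.decide_eq_true, Lit.eval]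

/-! ## §3 Arithmetic bookkeeping -/

/-- The largest `n` with `(n+2)^A ≤ K` (`A ≥ 1`, `K ≥ 2^A`). [folklore] -/
theorem exists_pow_le_lt {A K : ℕ} (hA : 1 ≤ A) (hK : 2 ^ A ≤ K) :
    ∃ n, (n + 2) ^ A ≤ K ∧ K < (n + 3) ^ A := by
  set x := Nat.findGreatest (fun n => (n + 2) ^ A ≤ K) K with hx
  refine ⟨x, Nat.findGreatest_spec (P := fun n => (n + 2) ^ A ≤ K) (Nat.zero_le K)
    (by simpa using hK), ?_⟩
  by_contra h
  push Not at h
  have h3 : x + 3 ≤ (x + 3) ^ A := le_self_pow₀ (by omega) (by omega)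
  have hP : (x + 1 + 2) ^ A ≤ K := by rwa [show x + 1 + 2 = x + 3 by omega]
  have hxx : x + 1 ≤ x :=
    Nat.le_findGreatest (P := fun n => (n + 2) ^ A ≤ K) (m := x + 1) (by omega) hP
  omega

/-- `m ≤ ⌈m^{1/4}⌉₊^4`. [folklore] -/
theorem le_ceil_rpow_quarter_pow (m : ℕ) : m ≤ ⌈(m : ℝ) ^ (1 / 4 : ℝ)⌉₊ ^ 4 := by
  have h0 : (0 : ℝ) ≤ (m : ℝ) ^ (1 / 4 : ℝ) := by positivity
  have h1 : ((m : ℝ) ^ (1 / 4 : ℝ)) ^ (4 : ℕ) = m := by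
    rw [← Real.rpow_natCast, ← Real.rpow_mul (Nat.cast_nonneg m)]
    norm_num
  have h2 : (m : ℝ) ≤ ((⌈(m : ℝ) ^ (1 / 4 : ℝ)⌉₊ : ℕ) : ℝ) ^ 4 :=
    calc (m : ℝ) = ((m : ℝ) ^ (1 / 4 : ℝ)) ^ (4 : ℕ) := h1.symm
      _ ≤ _ := pow_le_pow_left₀ h0 (Nat.le_ceil _) 4
  exact_mod_cast h2

/-- Size bookkeeping: `m ≤ K^4`, `K < (n+3)^A`, `n ≥ 3`, `m ≥ 2` give `3m² + m^c ≤ n^{8A(c+4)}` and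
`m^c ≤ n^{8A(c+4)}`. [folklore] -/
theorem size_bookkeeping {m n K A c : ℕ} (hmK : m ≤ K ^ 4) (hKn : K < (n + 3) ^ A) (hn : 3 ≤ n)
    (hm : 2 ≤ m) :
    3 * m ^ 2 + m ^ c ≤ n ^ (8 * A * (c + 4)) ∧ m ^ c ≤ n ^ (8 * A * (c + 4)) := by
  have hn3 : n + 3 ≤ n ^ 2 := by nlinarith
  have hmn : m ≤ n ^ (8 * A) :=
    calc m ≤ K ^ 4 := hmK
      _ ≤ ((n + 3) ^ A) ^ 4 := Nat.pow_le_pow_left hKn.le 4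
      _ ≤ ((n ^ 2) ^ A) ^ 4 := Nat.pow_le_pow_left (Nat.pow_le_pow_left hn3 A) 4
      _ = n ^ (8 * A) := by rw [← pow_mul, ← pow_mul]; ring
  have h1 : 1 ≤ m := by omega
  have hc4 : m ^ c ≤ m ^ (c + 4) := Nat.pow_le_pow_right h1 (by omega)
  have htot : 3 * m ^ 2 + m ^ c ≤ m ^ (c + 4) := by
    have h4 : 4 ≤ m ^ 2 := by nlinarith
    have hc2 : m ^ c ≤ m ^ (c + 2) := Nat.pow_le_pow_right h1 (by omega)
    have h22 : m ^ 2 ≤ m ^ (c + 2) := Nat.pow_le_pow_right h1 (by omega)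
    calc 3 * m ^ 2 + m ^ c ≤ 3 * m ^ (c + 2) + m ^ (c + 2) :=
          add_le_add (Nat.mul_le_mul_left 3 h22) hc2
      _ = 4 * m ^ (c + 2) := by ring
      _ ≤ m ^ 2 * m ^ (c + 2) := Nat.mul_le_mul_right _ h4
      _ = m ^ (c + 4) := by ring
  have hfin : m ^ (c + 4) ≤ n ^ (8 * A * (c + 4)) :=
    calc m ^ (c + 4) ≤ (n ^ (8 * A)) ^ (c + 4) := Nat.pow_le_pow_left hmn _
      _ = n ^ (8 * A * (c + 4)) := by rw [← pow_mul]
  exact ⟨htot.trans hfin, hc4.trans hfin⟩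

-- adapted from Theorems/CliqueExtLowerBound/Negative/DeltaMonotone.lean
-- (`eventually_two_mul_ceil_rpow_le`, same statement; a private copy keeps the imports small)
/-- Eventually `2·(⌈m^δ⌉₊ + 1) ≤ m` for `δ < 1`. [folklore] -/
private theorem eventually_two_mul_ceil_le {δ : ℝ} (h1 : δ < 1) :
    ∀ᶠ m : ℕ in atTop, 2 * (⌈(m : ℝ) ^ δ⌉₊ + 1) ≤ m := by
  have hpos : 0 < 1 - δ := by linarith
  set R : ℝ := (4 : ℝ) ^ (1 / (1 - δ)) with hR
  filter_upwards [eventually_ge_atTop (max 8 ⌈R⌉₊)] with m hm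
  have hm8 : 8 ≤ m := le_of_max_le_left hm
  have hmR : R ≤ m := (Nat.le_ceil R).trans (by exact_mod_cast le_of_max_le_right hm)
  have hm0 : (0 : ℝ) < m := by exact_mod_cast (show 0 < m by omega)
  have h4 : (4 : ℝ) ≤ (m : ℝ) ^ (1 - δ) := by
    calc (4 : ℝ) = R ^ (1 - δ) := by
          rw [hR, ← Real.rpow_mul (by norm_num), one_div, inv_mul_cancel₀ hpos.ne', Real.rpow_one]
      _ ≤ (m : ℝ) ^ (1 - δ) := Real.rpow_le_rpow (by positivity) hmR hpos.le
  have hδ : (m : ℝ) ^ δ ≤ m / 4 := by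
    have hsplit : (m : ℝ) = (m : ℝ) ^ δ * (m : ℝ) ^ (1 - δ) := by
      rw [← Real.rpow_add hm0, add_sub_cancel, Real.rpow_one]
    rw [le_div_iff₀ (by norm_num : (0 : ℝ) < 4)]
    calc (m : ℝ) ^ δ * 4 ≤ (m : ℝ) ^ δ * (m : ℝ) ^ (1 - δ) :=
          mul_le_mul_of_nonneg_left h4 (by positivity)
      _ = m := hsplit.symm
  have hceil : (⌈(m : ℝ) ^ δ⌉₊ : ℝ) < (m : ℝ) ^ δ + 1 := Nat.ceil_lt_add_one (by positivity)
  have hreal : (2 : ℝ) * (⌈(m : ℝ) ^ δ⌉₊ + 1) ≤ m := by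
    have : (8 : ℝ) ≤ m := by exact_mod_cast hm8
    linarith
  exact_mod_cast hreal

/-- The convex family `{∧₂, ∨₂} ∪ CONV_s` is monotone in `s`. [folklore] -/
private theorem convFamily_mono :
    Monotone fun s => ({GateFn.and 2, GateFn.or 2} ∪ {g | IsConvGate s g} : Set GateFn) := by
  rintro s t hst g (hg | hg)
  · exact Or.inl hg
  · exact Or.inr (IsConvGate.mono hg hst)

/-! ## §4 The transport -/

/-- **Generic transport (stub `Transport` of the line).** If every `f n` is a monotone
AND-projection of some `CLIQUE(M, k)` with `M, k ≤ (n+2)^a`, then CONV-blindness of `f` implies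
`ConvexGateBlind`: contrapositively, cheap `{∧₂, ∨₂} ∪ CONV` circuits for `CLIQUE(m, ⌈m^{1/4}⌉₊)` at
infinitely many `m` restrict — along the embedding of `K_M` into `K_m` with `⌈m^{1/4}⌉₊ - k` apexes
and the other new vertices isolated, literals replaced by single gates — to cheap circuits for
`f n` at infinitely many `n`. [folklore] -/
theorem stub_transport : Transport := by
  intro P f hproj hblind
  obtain ⟨a, ha⟩ := hproj
  -- WLOG the exponent is `≥ 1`
  obtain ⟨A, hA1, hA⟩ : ∃ A, 1 ≤ A ∧
      ∀ n, ∃ M k, M ≤ (n + 2) ^ A ∧ k ≤ (n + 2) ^ A ∧ ProjectsOnto M k (f n) := by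
    refine ⟨a + 1, by omega, fun n => ?_⟩
    obtain ⟨M, k, hM, hk, hP⟩ := ha n
    have hmono : (n + 2) ^ a ≤ (n + 2) ^ (a + 1) := Nat.pow_le_pow_right (by omega) (by omega)
    exact ⟨M, k, hM.trans hmono, hk.trans hmono, hP⟩
  show ∃ δ : ℝ, 0 < δ ∧ δ < 1 / 2 ∧
    LowerBoundAtOver (fun s => {GateFn.and 2, GateFn.or 2} ∪ {g | IsConvGate s g})
      (fun m => ⌈(m : ℝ) ^ δ⌉₊)
  refine ⟨1 / 4, by norm_num, by norm_num, ?_⟩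
  by_contra hLB
  simp only [LowerBoundAtOver, not_forall, Filter.not_eventually, not_not] at hLB
  obtain ⟨c, hc⟩ := hLB
  -- the blindness threshold at the exponent `8A(c+4)`
  obtain ⟨N, hN⟩ := Filter.eventually_atTop.1 (hblind (8 * A * (c + 4)))
  -- a large easy `m`
  have htend : Tendsto (fun m : ℕ => ⌈(m : ℝ) ^ (1 / 4 : ℝ)⌉₊) atTop atTop :=
    tendsto_nat_ceil_atTop.comp
      ((tendsto_rpow_atTop (by norm_num)).comp tendsto_natCast_atTop_atTop)
  obtain ⟨m, ⟨hT, h2K, hm2⟩, C, hC, hsize, hcomp⟩ :=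
    (((htend.eventually_ge_atTop ((max N 3 + 2) ^ A)).and
      ((eventually_two_mul_ceil_le (show (1 / 4 : ℝ) < 1 by norm_num)).and
        (eventually_ge_atTop 2))).and_frequently hc).exists
  have hK2 : 2 ≤ ⌈(m : ℝ) ^ (1 / 4 : ℝ)⌉₊ := two_le_ceil_rpow (by norm_num) hm2
  have hmK : m ≤ ⌈(m : ℝ) ^ (1 / 4 : ℝ)⌉₊ ^ 4 := le_ceil_rpow_quarter_pow m
  generalize hKdef : ⌈(m : ℝ) ^ (1 / 4 : ℝ)⌉₊ = K at hT h2K hcomp hK2 hmK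
  -- the instance size `n`: the largest `n` with `(n+2)^A ≤ K`
  obtain ⟨n, hnK, hKn⟩ := exists_pow_le_lt hA1 ((Nat.pow_le_pow_left (by omega) A).trans hT)
  have hn : max N 3 ≤ n := by
    by_contra hlt
    push Not at hlt
    have : (n + 3) ^ A ≤ (max N 3 + 2) ^ A := Nat.pow_le_pow_left (by omega) A
    omega
  have hNn : N ≤ n := le_of_max_le_left hn
  have hn3 : 3 ≤ n := le_of_max_le_right hn
  -- the projection of `f n` onto `CLIQUE(M, k)` and the board `K_M ⊆ K_{m₂} ⊆ K_m`
  obtain ⟨M, k, hM, hk, ρ, hρ⟩ := hA n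
  have hMK : M ≤ K := hM.trans hnK
  have hkK : k ≤ K := hk.trans hnK
  obtain ⟨m₂, hm₂⟩ : ∃ m₂, m₂ = M + (K - k) := ⟨_, rfl⟩
  have hMm₂ : M ≤ m₂ := by omega
  have hm₂m : m₂ ≤ m := by omega
  have hKk : K = k + (m₂ - M) := by omega
  -- the basis at level `m^c` has `∧₂` and both constants
  have h1mc : 1 ≤ m ^ c := Nat.one_le_pow _ _ (by omega)
  set B : Set GateFn := {GateFn.and 2, GateFn.or 2} ∪ {g | IsConvGate (m ^ c) g} with hB
  have hAnd : GateFn.and 2 ∈ B := Or.inl (Set.mem_insert _ _)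
  have hTrue : (⟨0, fun _ => true⟩ : GateFn) ∈ B :=
    Or.inr ((isConvGate_constTrue 0).mono (Nat.zero_le _))
  have hFalse : GateFn.or 0 ∈ B := Or.inr ((or_isConvGate 0).mono h1mc)
  -- the circuit: literals, apex padding, zero padding, then `C`
  have h1 : CktSize B (fun (v : P n → Bool) (e' : E M) => (ρ e').eval v) (Fintype.card (E M) * 1) :=
    CktSize.pi_const fun e' => cktSize_lit hTrue hFalse hAnd (ρ e')
  obtain ⟨C', hC', hs', he'⟩ :=
    (((h1.comp (cktSize_padVec hMm₂ hTrue)).comp (cktSize_zeroVec hm₂m hFalse)).comp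
      (cktSize_ofCircuit C hC)).toCircuit
  obtain ⟨hsz, hbas⟩ := size_bookkeeping (c := c) hmK hKn hn3 hm2
  refine hN n hNn C' (hC'.mono (convFamily_mono hbas)) ?_ fun v => ?_
  · -- size `≤ #E(K_M) + #E(K_{m₂}) + #E(K_m) + m^c ≤ 3m² + m^c`
    have hEM := card_E_le M; have hEm₂ := card_E_le m₂; have hEm := card_E_le m
    have hM2 : M ^ 2 ≤ m ^ 2 := Nat.pow_le_pow_left (by omega) 2
    have hm₂2 : m₂ ^ 2 ≤ m ^ 2 := Nat.pow_le_pow_left hm₂m 2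
    omega
  · -- correctness: `CLIQUE(m, K) ∘ zeroVec ∘ padVec ∘ ρ = CLIQUE(M, k) ∘ ρ = f n`
    have key : C.eval (zeroVec hm₂m (padVec hMm₂ fun e' => (ρ e').eval v)) = f n v := by
      rw [hcomp _, cliqueFn_zeroVec hm₂m _ hK2, hKk, cliqueFn_padVec, hρ]
    exact (he' v).trans key

end Summit.PneNP.PneNP.Theorems.XorDoor
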